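import Mathlib
import Summits.MatrixMultiplication.MatrixMultiplication.Theorems.SoloBlindMaximalZSF

/-!
# Solo-blind seat (MatrixMultiplication), s68 — direct sums of maximal zero-sum-free families
(paper/ZSF-classification.md, TRIANGLE.md (R18.15f), CLAIMS c677 (b))

Companion to `SoloBlindMaximalZSF`: zero-sum freeness, injectivity and the "stuck" property (every element
`c` has `c + Σ_T h = 0` for some sub-family `T`, i.e. nothing can be appended) are preserved under the direct sum
of two families `ι → G`, `κ → H` into `G × H` (`soloBlindJoin`).  Consequently the rank-6 example propagates: for
every injective zero-sum-free stuck family `g` in a group `H` (e.g. a maximum zero-sum-free subset of `𝔽₃ᵏ`,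
`k ≥ 3`), `𝔽₃⁶ × H` carries an injective zero-sum-free stuck family indexed by `Fin 11 ⊕ κ`
(`soloBlind_maximal_product`) — maximal zero-sum-free sets one short of the maximum size in every rank `≥ 9`
(ranks 7 and 8 have direct examples).  Pure finite combinatorics; no `ω` content by itself.
-/

set_option linter.dupNamespace false
set_option autoImplicit false

namespace Summit.MatrixMultiplication.MatrixMultiplication.Theorems

open Finset BigOperators

section Product

variable {ι κ G H : Type*} [AddCommGroup G] [AddCommGroup H]

/-- The direct sum of a family in `G` and a family in `H`, as a family in `G × H`. -/
def soloBlindJoin (f : ι → G) (g : κ → H) : ι ⊕ κ → G × H :=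
  Sum.elim (fun i => (f i, 0)) (fun j => (0, g j))

/-- Left components of the join. -/
@[simp] theorem soloBlindJoin_inl (f : ι → G) (g : κ → H) (i : ι) :
    soloBlindJoin f g (Sum.inl i) = (f i, 0) := rfl

/-- Right components of the join. -/
@[simp] theorem soloBlindJoin_inr (f : ι → G) (g : κ → H) (j : κ) :
    soloBlindJoin f g (Sum.inr j) = (0, g j) := rfl

/-- A sub-sum of the join is the pair of the sub-sums of its left and right parts. -/
theorem soloBlindJoin_sum (f : ι → G) (g : κ → H) (T : Finset (ι ⊕ κ)) :
    ∑ x ∈ T, soloBlindJoin f g x = (∑ i ∈ T.toLeft, f i, ∑ j ∈ T.toRight, g j) := by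
  rw [Finset.sum_sum_eq_sum_toLeft_add_sum_toRight]
  simp only [soloBlindJoin_inl, soloBlindJoin_inr]
  ext
  · simp only [Prod.fst_add, Prod.fst_sum, Finset.sum_const_zero, add_zero]
  · simp only [Prod.snd_add, Prod.snd_sum, Finset.sum_const_zero, zero_add]

/-- Zero-sum freeness is preserved by the direct sum. -/
theorem soloBlind_join_zsf (f : ι → G) (g : κ → H)
    (hf : ∀ T : Finset ι, ∑ i ∈ T, f i = 0 → T = ∅)
    (hg : ∀ T : Finset κ, ∑ j ∈ T, g j = 0 → T = ∅)
    (T : Finset (ι ⊕ κ)) (hT : ∑ x ∈ T, soloBlindJoin f g x = 0) : T = ∅ := by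
  rw [soloBlindJoin_sum, Prod.mk_eq_zero] at hT
  rw [← Finset.toLeft_disjSum_toRight (u := T), hf _ hT.1, hg _ hT.2]
  exact Finset.disjSum_eq_empty.mpr ⟨rfl, rfl⟩

/-- The "stuck" property (full sumset up to sign: every element is cancelled by some sub-sum) is preserved. -/
theorem soloBlind_join_stuck (f : ι → G) (g : κ → H)
    (hf : ∀ a : G, ∃ T : Finset ι, a + ∑ i ∈ T, f i = 0)
    (hg : ∀ b : H, ∃ T : Finset κ, b + ∑ j ∈ T, g j = 0)
    (c : G × H) : ∃ T : Finset (ι ⊕ κ), c + ∑ x ∈ T, soloBlindJoin f g x = 0 := by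
  obtain ⟨T₁, h₁⟩ := hf c.1
  obtain ⟨T₂, h₂⟩ := hg c.2
  refine ⟨T₁.disjSum T₂, ?_⟩
  rw [soloBlindJoin_sum, Finset.toLeft_disjSum, Finset.toRight_disjSum]
  ext
  · simpa using h₁
  · simpa using h₂

/-- A zero-sum-free family has no zero term. -/
theorem soloBlind_ne_zero_of_zsf (f : ι → G) (hf : ∀ T : Finset ι, ∑ i ∈ T, f i = 0 → T = ∅) (i : ι) :
    f i ≠ 0 := by
  intro h
  have := hf {i} (by rw [Finset.sum_singleton, h])
  exact absurd this (Finset.singleton_ne_empty i)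

/-- Injectivity is preserved by the direct sum (given that the left family has no zero term). -/
theorem soloBlind_join_injective (f : ι → G) (g : κ → H) (hf : Function.Injective f)
    (hg : Function.Injective g) (hf0 : ∀ i, f i ≠ 0) : Function.Injective (soloBlindJoin f g) := by
  rintro (i | j) (i' | j') h
  · simp only [soloBlindJoin_inl, Prod.mk.injEq] at h
    rw [hf h.1]
  · simp only [soloBlindJoin_inl, soloBlindJoin_inr, Prod.mk.injEq] at h
    exact absurd h.1 (hf0 i)
  · simp only [soloBlindJoin_inl, soloBlindJoin_inr, Prod.mk.injEq] at h
    exact absurd h.1.symm (hf0 i')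
  · simp only [soloBlindJoin_inr, Prod.mk.injEq] at h
    rw [hg h.2]

end Product

/-- PROPAGATION OF THE RANK-6 EXAMPLE (CLAIMS c677 (b)): for every injective, zero-sum-free, stuck family `g` in a
group `H`, the direct sum with `soloBlindMax11` is an injective, zero-sum-free, stuck family in `𝔽₃⁶ × H` indexed by
`Fin 11 ⊕ κ` — one element SHORT of `12 + |κ|`.  With `H = 𝔽₃ᵏ` and `g` a maximum zero-sum-free `2k`-set (`k ≥ 3`)
this is an inclusion-maximal zero-sum-free subset of `𝔽₃^{6+k}` of size `2(6+k) - 1`. -/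
theorem soloBlind_maximal_product {κ H : Type*} [AddCommGroup H] (g : κ → H)
    (hg_inj : Function.Injective g)
    (hg_zsf : ∀ T : Finset κ, ∑ j ∈ T, g j = 0 → T = ∅)
    (hg_stuck : ∀ b : H, ∃ T : Finset κ, b + ∑ j ∈ T, g j = 0) :
    ∃ h : Fin 11 ⊕ κ → SoloBlindG6 × H, Function.Injective h ∧
      (∀ T : Finset (Fin 11 ⊕ κ), ∑ x ∈ T, h x = 0 → T = ∅) ∧
      (∀ c : SoloBlindG6 × H, ∃ T : Finset (Fin 11 ⊕ κ), c + ∑ x ∈ T, h x = 0) := by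
  have hstuck : ∀ a : SoloBlindG6, ∃ T : Finset (Fin 11), a + ∑ i ∈ T, soloBlindMax11 i = 0 := by
    intro a
    obtain ⟨T, hT⟩ := soloBlindMax11_complete (-a)
    exact ⟨T, by rw [hT, add_neg_cancel]⟩
  exact ⟨soloBlindJoin soloBlindMax11 g,
    soloBlind_join_injective _ _ soloBlindMax11_injective hg_inj
      (soloBlind_ne_zero_of_zsf _ soloBlindMax11_zsf),
    soloBlind_join_zsf _ _ soloBlindMax11_zsf hg_zsf,
    soloBlind_join_stuck _ _ hstuck hg_stuck⟩

end Summit.MatrixMultiplication.MatrixMultiplication.Theorems
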